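import Literature.NumberTheory.EllipticCurves.Zhai2016.NonvanishingQuadraticTwists
import HarnessLib

/-!
# Zhai 2016, *Non-vanishing theorems for quadratic twists of elliptic curves* — ERRATUM (arXiv v2, 2017):
# the standing assumption «the Manin constant `ν_E` is odd» and the restriction `E[2](ℚ) ≠ 0` of Thms. 1.3/1.5

HONEST FRAMING (cell `b2b-bsdres`, sub-lane «bsd-p2»; pen = p2-typer GEN 21 on behalf of the retired
p2-lit-1 lineage, p2-lead WAKE-T-156 / LEAD-OKS BATCH 61 (vii); literature registry flags of lit GEN 98:
`Zhai16-v2-odd-Manin-standing-assumption` on A283/A284/A285/A287 and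
`Zhai16-Thm1.3/1.5-E[2](ℚ)≠0-not-transcribed` on A285/A287): PUBLISHED theorems vendored as named `Prop`s
(nothing asserted, nothing discharged; D-0014). This file is the ERRATUM companion of
`Zhai2016/NonvanishingQuadraticTwists.lean` (p313726): that file's named facts
`thm11_ordTwo_LAlg_twist_eq_zero`, `thm12_ordTwo_LAlg_twist_eq_one`, `thm13_ordTwo_LAlg_primeTwist_eq_zero`,
`thm15_ordTwo_LAlg_primeTwist_eq_one` transcribe the arXiv **v1** text (2014-08-31 = the store text
`paper:arxiv-1409.0231`), in which the words "Manin constant" do not occur. arXiv **v2** (2017-12-03,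
posted AFTER the journal publication Asian J. Math. 20 (2016) 475–502) adds a STANDING ASSUMPTION and
re-states every theorem with it; it also writes the restriction `E[2](ℚ) ≠ 0` INTO Thms. 1.3/1.5 (v1
carried it only as the running sentence "For curves `E` with `E[2](ℚ) ≠ 0`, we have only been able to
establish the following much weaker results", v1 p. 3) and the coprimality `(M, C) = 1` / `(q, C) = 1`
into each theorem (already a binder of the v1 transcription: `Int.gcd M C = 1` / `¬ q ∣ C`). The v1
facts bind `Zhai2021.IsOptimalDatum W Dt` with `Dt.c` (the Manin constant) ANY integer, so AS TYPED they
are STRONGER than the author's corrected statements whenever the conductor is even (odd conductor: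
Abbes–Ullmo make `ν_E` odd — a theorem to cite, not a binder to omit). MIS-STATED protocol: the OLD
declarations are left UNTOUCHED (statements byte-identical, still importable); the CORRECTED statements
are declared HERE beside them as PRIMED TWINS (`…'`), each = the old text + the binder
`¬ (2 : ℤ) ∣ Dt.c` ("odd Manin constant", the idiom of `Zhai2021/TwoAdicLowerBoundTwists.lean` for the
same author's 2021 paper; `CaiLiZhai2019.IsOptimalDatumWithOddManinConstant W Dt` is the conjunction —
`isOptimalDatumWithOddManinConstant_iff` below), and for Thms. 1.3/1.5 also
`Nat.card E(ℚ)[2] ≠ 1` (`E[2](ℚ) ≠ 0`, the file's own idiom). §3 records kernel-visibly that each v1 fact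
IMPLIES its primed twin (the correction only WEAKENS). Journal text unread (acq-10402, lit GEN 98): it
decides only whether the docstrings should say «as printed in Asian J. Math.» or «post-publication
correction (arXiv v2)»; the author's own v2 is authoritative either way (p2-lead BATCH 61 (vii)).
Consumers: `Summits/…/P2/CountsAtTwoZhai16Erratum.lean` (the corrected COUNT forms); the v1 consumers in
`P2/CountsAtTwoZhai16.lean` §2–§3 are MIS-STATED-PENDING for p2 (conditional on hypotheses too strong to
be discharged from print for even conductor); §4 (Thm. 1.4, Neumann–Setzer, prime conductor) and
`thm14_neumannSetzer_twists` are UNAFFECTED (odd conductor `p = u² + 64`). Nothing booked; no mark moved.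

Source of the correction. S. Zhai, arXiv:1409.0231**v2** (3 Dec 2017), `main.tex` (lit GEN 98 eprint
`HOME/b2b-bsdres-lit/g98/eprints/zhainv_v2/main.tex` @872bee9cdcd000d2; v1 ↔ v2 diff
`g98/g98_zhainv_v1_v2.diff.txt`). Verbatim (v2 §1, TeX ll. 255–263): "throughout the present paper, we
shall always assume that `E` is indeed optimal. The pull-back by `φ` of a Néron differential on a global
minimal Weierstrass equation for `E` is then given by a rational multiple, whose absolute value we denote
by `ν_E`, of the differential associated to the normalized new … cuspidal eigenform `f = f_E` … Throughout
the present paper we shall, for simplicity, always make the standing assumption:- **Assumption.** *The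
Manin constant `ν_E` is odd.* We remark that Abbes–Ullmo have proven this assumption whenever `C_E` is an
odd integer." (and l. 267: "Throughout this paper, we always assume that the Manin constant is always
odd. By [Abbes] this is no assumption at all if the conductor of the elliptic curve is odd, and the
conjecture that the Manin constant is always `1` has been verified numerically by Cremona for all curves
of conductor less than `60000`.")
* **v2 Theorem 1.1** (label `thm1`, TeX l. 273–279; = v1 Thm. 1.1): "Let `E` be an optimal elliptic curve
  over `ℚ`, with odd Manin constant. Assume that `E` has negative discriminant, and satisfies
  `E[2](ℚ) = 0` and `ord₂(L^{(alg)}(E,1)) = 0`. Let `M` be any integer of the form `M = ε q₁q₂⋯q_r`,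
  satisfying `(M, C) = 1`, where `C` is the conductor of `E`, `r ≥ 1`, `q₁, …, q_r` are arbitrary distinct
  odd primes which are inert in the field `F`, and the sign `ε = ±1` is chosen so that `M ≡ 1 mod 4`.
  Then `L(E^{(M)},1) ≠ 0`, and we have `ord₂(L^{(alg)}(E^{(M)},1)) = 0`. Hence, `E^{(M)}(ℚ)` and
  `Ш(E^{(M)}(ℚ))` are finite."
* **v2 Theorem 1.3** (label `thm1-1`, TeX l. 315–321; = v1 Thm. 1.2): "Let `E` be an optimal elliptic
  curve over `ℚ`, with odd Manin constant. Assume that `E` has positive discriminant, and satisfies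
  `E[2](ℚ) = 0` and `ord₂(L^{(alg)}(E,1)) = 1`. Let `M` be any positive integer of the form
  `M = q₁q₂⋯q_r`, satisfying `(M, C) = 1`, where `C` is the conductor of `E`, `r ≥ 1`, `q₁, …, q_r` are
  arbitrary distinct odd primes which are inert in the field `F`, and `M ≡ 1 mod 4`. Then
  `L(E^{(M)},1) ≠ 0`, and we have `ord₂(L^{(alg)}(E^{(M)},1)) = 1`. Hence, `E^{(M)}(ℚ)` and
  `Ш(E^{(M)}(ℚ))` are finite."
* **v2 Theorem 1.5** (label `thm2`, TeX l. 350–356; = v1 Thm. 1.3): "Let `E` be an optimal elliptic curve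
  over `ℚ`, with odd Manin constant. Assume that `E` has negative discriminant, and satisfies
  `E[2](ℚ) ≠ 0` and `L(E,1) ≠ 0`. Let `M` be any integer of the form `M = ε q`, where `q` is an
  arbitrary odd prime with `(q, C) = 1`, where `C` is the conductor of `E`, and the sign `ε = ±1` is
  chosen so that `M ≡ 1 mod 4`. If `ord₂(N_q) = −ord₂(L^{(alg)}(E,1)) ≠ 0`, then `L(E^{(M)},1) ≠ 0`,
  and we have `ord₂(L^{(alg)}(E^{(M)},1)) = 0`. Hence, `E^{(M)}(ℚ)` and `Ш(E^{(M)}(ℚ))` are finite."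
* **v2 Theorem 1.7** (label `thm2-1`, TeX l. 393–399; = v1 Thm. 1.5): "Let `E` be an optimal elliptic
  curve over `ℚ`, with odd Manin constant. Assume that `E` has positive discriminant, and satisfies
  `E[2](ℚ) ≠ 0` and `L(E,1) ≠ 0`. Let `q` be any odd prime with `q ≡ 1 mod 4`, and `(q, C) = 1`, where
  `C` is the conductor of `E`. If `ord₂(N_q) = 1 − ord₂(L^{(alg)}(E,1)) ≠ 0`, then `L(E^{(q)},1) ≠ 0`,
  and we have `ord₂(L^{(alg)}(E^{(q)},1)) = 1`. Hence, `E^{(q)}(ℚ)` and `Ш(E^{(q)}(ℚ))` are finite."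
(v2 also inserts NEW Thms. 1.2/1.4 — the `2`-part of BSD for these twists when the bad primes of `E`
split in `ℚ(√M)` and the `2`-part of BSD holds for `E` — NOT vendored here; v1 Thm. 1.4 = v2 Thm. 1.6
(Neumann–Setzer) is unchanged in substance.) Theorem NUMBERS below keep the v1 = journal numbering of
the companion file (1.1 / 1.2 / 1.3 / 1.5).

Transcription: as in the companion file (its dictionary applies verbatim), plus: "odd Manin constant" =
`¬ (2 : ℤ) ∣ Dt.c` for the datum `Dt : ModularParametrizationData W C` (`Dt.c` = the Manin constant,
`ModularParametrizationData.maninConstant`); "`E[2](ℚ) ≠ 0`" = `Nat.card {P // 2 • P = 0} ≠ 1`.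
No `_holds` expected. Consumers take `(h : thm11_ordTwo_LAlg_twist_eq_zero')` etc.

## References
* [Zhai2016] S. Zhai, Asian J. Math. 20 (2016) no. 3, 475–502, doi:10.4310/ajm.2016.v20.n3.a4; arXiv:1409.0231
  v1 (2014) Thms. 1.1/1.2/1.3/1.5 (chunks p0002 L22–L29, p0003 L11–L18, L51–L58, L105–L110) = v2 (2017)
  Thms. 1.1/1.3/1.5/1.7 (TeX ll. 273–279, 315–321, 350–356, 393–399) with the standing assumption (ll. 255–263).
* [AbbesUllmo1996] A. Abbes, E. Ullmo, Compositio Math. 103 (1996) 269–286 (`ν_E` odd for odd conductor; cited, not used).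
* [Zhai2021BSDExactFormulaTwists], [CaiLiZhai2019] (tree files supplying the two idioms for "odd Manin constant").
-/

noncomputable section

open scoped Classical MatrixGroups ModularForm

open CongruenceSubgroup NumberField WeierstrassCurve Literature.NumberTheory.EllipticCurves
  Literature.NumberTheory.EllipticCurves.ModularForms
  Literature.NumberTheory.EllipticCurves.CaiLiZhai2019
  Literature.NumberTheory.EllipticCurves.Zhai2021
  Literature.NumberTheory.EllipticCurves.CoatesLiTianZhai2015

namespace Literature.NumberTheory.EllipticCurves.Zhai2016

/-! ### §1. The two idioms for "optimal with odd Manin constant" agree (bookkeeping, proved) -/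

/-- `CaiLiZhai2019.IsOptimalDatumWithOddManinConstant W Dt` (the lattice equality ∧ `2 ∤ maninConstant`)
is, by definition, `Zhai2021.IsOptimalDatum W Dt ∧ ¬ 2 ∣ Dt.c` — so consumers holding either idiom feed
the corrected facts below. [cite: CaiLiZhai2019, §2 (arXiv:1712.01271 chunk p0005 L5–L16) and Thm. 1.1 hypothesis (1)] -/
theorem isOptimalDatumWithOddManinConstant_iff (W : WeierstrassCurve ℚ) {N : ℕ} [NeZero N]
    (Dt : ModularParametrizationData W N) :
    IsOptimalDatumWithOddManinConstant W Dt ↔ IsOptimalDatum W Dt ∧ ¬ (2 : ℤ) ∣ Dt.c :=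
  Iff.rfl

/-! ### §2. The corrected statements (named facts, PRIMED TWINS of the companion file's; nothing asserted) -/

/-- **Zhai 2016, Theorem 1.1 — CORRECTED (arXiv v2, 2017: "with odd Manin constant")** (verbatim in
the module docstring). The companion file's `thm11_ordTwo_LAlg_twist_eq_zero` plus the binder
`¬ 2 ∣ Dt.c` (the Manin constant of the optimal parametrisation is odd), inserted after the optimality
datum; everything else byte-identical: `Δ_E < 0`, `E[2](ℚ) = 0`, `ord₂(L(E,1)/Ω_∞(E)) = 0`, `F` the cubic
`2`-division field, `M` square-free, `M ≡ 1 (mod 4)`, `(M, C) = 1`, `r ≥ 1` odd prime factors inert in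
`F`, `WM` a globally minimal model of `E^{(M)}` ⟹ `ord₂(L(E^{(M)},1)/Ω_∞(E^{(M)})) = 0`, `L(E^{(M)},1) ≠ 0`,
`E^{(M)}(ℚ)` and `Ш(E^{(M)})` finite. AT 2, analytic rank ZERO. No `_holds` expected.
[cite: Zhai2016, Thm. 1.1 (arXiv:1409.0231v2 TeX ll. 273–279; standing assumption ll. 255–263; v1 chunk p0002 L22–L29)] -/
def thm11_ordTwo_LAlg_twist_eq_zero' : Prop :=
  ∀ (W : WeierstrassCurve ℚ) [W.IsElliptic] [W.IsGloballyMinimal] [NeZero (W.conductorNorm ℤ)]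
    (Dt : ModularParametrizationData W (W.conductorNorm ℤ)), IsOptimalDatum W Dt → ¬ (2 : ℤ) ∣ Dt.c →
    W.Δ < 0 → Nat.card {P : W.toAffine.Point // (2 : ℕ) • P = 0} = 1 →
    (∃ x : ℚ, IsLAlg W x ∧ x ≠ 0 ∧ padicValRat 2 x = 0) →
    ∀ (F : Type) [Field F] [NumberField F], IsTwoDivisionField W F →
    ∀ (M : ℤ), Squarefree M → M % 4 = 1 → Int.gcd M (W.conductorNorm ℤ) = 1 →
      M.natAbs.primeFactors.Nonempty → (∀ q ∈ M.natAbs.primeFactors, q ≠ 2 ∧ IsInertIn F q) →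
    ∀ (WM : WeierstrassCurve ℚ) [WM.IsElliptic] [WM.IsGloballyMinimal],
      (∃ C : VariableChange ℚ, C • W.quadraticTwist (M : ℚ) = WM) →
        (∃ x : ℚ, IsLAlg WM x ∧ x ≠ 0 ∧ padicValRat 2 x = 0) ∧
        WM.entireLFunction 1 ≠ 0 ∧ Finite WM.toAffine.Point ∧ Finite WM.sha

/-- **Zhai 2016, Theorem 1.2 — CORRECTED (arXiv v2 Thm. 1.3, 2017: "with odd Manin constant")**
(verbatim in the module docstring). The companion file's `thm12_ordTwo_LAlg_twist_eq_one` plus the binder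
`¬ 2 ∣ Dt.c`; everything else byte-identical: `Δ_E > 0`, `E[2](ℚ) = 0`, `ord₂(L(E,1)/Ω_∞(E)) = 1`,
`M > 0` square-free, `M ≡ 1 (mod 4)`, `(M, C) = 1`, `r ≥ 1` odd prime factors inert in `F` ⟹
`ord₂(L(E^{(M)},1)/Ω_∞(E^{(M)})) = 1`, `L(E^{(M)},1) ≠ 0`, finiteness. AT 2, analytic rank ZERO.
No `_holds` expected.
[cite: Zhai2016, Thm. 1.2 (arXiv:1409.0231v2 Thm. 1.3, TeX ll. 315–321; standing assumption ll. 255–263; v1 chunk p0003 L11–L18)] -/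
def thm12_ordTwo_LAlg_twist_eq_one' : Prop :=
  ∀ (W : WeierstrassCurve ℚ) [W.IsElliptic] [W.IsGloballyMinimal] [NeZero (W.conductorNorm ℤ)]
    (Dt : ModularParametrizationData W (W.conductorNorm ℤ)), IsOptimalDatum W Dt → ¬ (2 : ℤ) ∣ Dt.c →
    0 < W.Δ → Nat.card {P : W.toAffine.Point // (2 : ℕ) • P = 0} = 1 →
    (∃ x : ℚ, IsLAlg W x ∧ x ≠ 0 ∧ padicValRat 2 x = 1) →
    ∀ (F : Type) [Field F] [NumberField F], IsTwoDivisionField W F →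
    ∀ (M : ℤ), 0 < M → Squarefree M → M % 4 = 1 → Int.gcd M (W.conductorNorm ℤ) = 1 →
      M.natAbs.primeFactors.Nonempty → (∀ q ∈ M.natAbs.primeFactors, q ≠ 2 ∧ IsInertIn F q) →
    ∀ (WM : WeierstrassCurve ℚ) [WM.IsElliptic] [WM.IsGloballyMinimal],
      (∃ C : VariableChange ℚ, C • W.quadraticTwist (M : ℚ) = WM) →
        (∃ x : ℚ, IsLAlg WM x ∧ x ≠ 0 ∧ padicValRat 2 x = 1) ∧
        WM.entireLFunction 1 ≠ 0 ∧ Finite WM.toAffine.Point ∧ Finite WM.sha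

/-- **Zhai 2016, Theorem 1.3 — CORRECTED (arXiv v2 Thm. 1.5, 2017: "with odd Manin constant … satisfies
`E[2](ℚ) ≠ 0` and `L(E,1) ≠ 0`")** (verbatim in the module docstring). The companion file's
`thm13_ordTwo_LAlg_primeTwist_eq_zero` plus TWO binders: `¬ 2 ∣ Dt.c` and `#E(ℚ)[2] ≠ 1` (print's
`E[2](ℚ) ≠ 0`, v1 p. 3 running sentence / v2 inside the theorem); everything else byte-identical:
`Δ_E < 0`, `L(E,1) ≠ 0` with algebraic value `x₀`, `q` an odd prime of good reduction (`q ∤ C`, print's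
`(q, C) = 1`) with `ord₂(N_q) = −ord₂(x₀) ≠ 0`, `M = ±q ≡ 1 (mod 4)` ⟹ `ord₂(L(E^{(M)},1)/Ω_∞) = 0`,
`L(E^{(M)},1) ≠ 0`, finiteness. AT 2, analytic rank ZERO. No `_holds` expected.
[cite: Zhai2016, Thm. 1.3 (arXiv:1409.0231v2 Thm. 1.5, TeX ll. 350–356; standing assumption ll. 255–263; v1 chunk p0003 L51–L60)] -/
def thm13_ordTwo_LAlg_primeTwist_eq_zero' : Prop :=
  ∀ (W : WeierstrassCurve ℚ) [W.IsElliptic] [W.IsGloballyMinimal] [NeZero (W.conductorNorm ℤ)]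
    (Dt : ModularParametrizationData W (W.conductorNorm ℤ)), IsOptimalDatum W Dt → ¬ (2 : ℤ) ∣ Dt.c →
    W.Δ < 0 → Nat.card {P : W.toAffine.Point // (2 : ℕ) • P = 0} ≠ 1 → W.entireLFunction 1 ≠ 0 →
    ∀ (x₀ : ℚ), IsLAlg W x₀ →
    ∀ (q : ℕ), q.Prime → q ≠ 2 → ¬ q ∣ W.conductorNorm ℤ →
      (padicValNat 2 (W.reductionPointCount q) : ℤ) = -padicValRat 2 x₀ →
      padicValNat 2 (W.reductionPointCount q) ≠ 0 →
    ∀ (M : ℤ), (M = q ∨ M = -q) → M % 4 = 1 →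
    ∀ (WM : WeierstrassCurve ℚ) [WM.IsElliptic] [WM.IsGloballyMinimal],
      (∃ C : VariableChange ℚ, C • W.quadraticTwist (M : ℚ) = WM) →
        (∃ x : ℚ, IsLAlg WM x ∧ x ≠ 0 ∧ padicValRat 2 x = 0) ∧
        WM.entireLFunction 1 ≠ 0 ∧ Finite WM.toAffine.Point ∧ Finite WM.sha

/-- **Zhai 2016, Theorem 1.5 — CORRECTED (arXiv v2 Thm. 1.7, 2017: "with odd Manin constant … satisfies
`E[2](ℚ) ≠ 0` and `L(E,1) ≠ 0`")** (verbatim in the module docstring). The companion file's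
`thm15_ordTwo_LAlg_primeTwist_eq_one` plus TWO binders: `¬ 2 ∣ Dt.c` and `#E(ℚ)[2] ≠ 1`; everything else
byte-identical: `Δ_E > 0`, `L(E,1) ≠ 0` with algebraic value `x₀`, `q ≡ 1 (mod 4)` a prime of good
reduction (`q ∤ C`) with `ord₂(N_q) = 1 − ord₂(x₀) ≠ 0` ⟹ `ord₂(L(E^{(q)},1)/Ω_∞) = 1`, `L(E^{(q)},1) ≠ 0`,
finiteness. AT 2, analytic rank ZERO. No `_holds` expected.
[cite: Zhai2016, Thm. 1.5 (arXiv:1409.0231v2 Thm. 1.7, TeX ll. 393–399; standing assumption ll. 255–263; v1 chunk p0003 L105–L110)] -/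
def thm15_ordTwo_LAlg_primeTwist_eq_one' : Prop :=
  ∀ (W : WeierstrassCurve ℚ) [W.IsElliptic] [W.IsGloballyMinimal] [NeZero (W.conductorNorm ℤ)]
    (Dt : ModularParametrizationData W (W.conductorNorm ℤ)), IsOptimalDatum W Dt → ¬ (2 : ℤ) ∣ Dt.c →
    0 < W.Δ → Nat.card {P : W.toAffine.Point // (2 : ℕ) • P = 0} ≠ 1 → W.entireLFunction 1 ≠ 0 →
    ∀ (x₀ : ℚ), IsLAlg W x₀ →
    ∀ (q : ℕ), q.Prime → q % 4 = 1 → ¬ q ∣ W.conductorNorm ℤ →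
      (padicValNat 2 (W.reductionPointCount q) : ℤ) = 1 - padicValRat 2 x₀ →
      padicValNat 2 (W.reductionPointCount q) ≠ 0 →
    ∀ (WM : WeierstrassCurve ℚ) [WM.IsElliptic] [WM.IsGloballyMinimal],
      (∃ C : VariableChange ℚ, C • W.quadraticTwist (q : ℚ) = WM) →
        (∃ x : ℚ, IsLAlg WM x ∧ x ≠ 0 ∧ padicValRat 2 x = 1) ∧
        WM.entireLFunction 1 ≠ 0 ∧ Finite WM.toAffine.Point ∧ Finite WM.sha

/-! ### §3. The correction only WEAKENS: each v1 statement (as typed) implies its primed twin (proved) -/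

/-- The v1 transcription of Thm. 1.1 (Manin constant arbitrary) implies the corrected statement (the extra
binder is discarded) — kernel record that the companion file's fact is the STRONGER `Prop`.
[cite: Zhai2016, Thm. 1.1 (arXiv:1409.0231 v1 chunk p0002 L22–L29 vs v2 TeX ll. 273–279)] -/
theorem thm11_ordTwo_LAlg_twist_eq_zero'_of_v1 (h : thm11_ordTwo_LAlg_twist_eq_zero) :
    thm11_ordTwo_LAlg_twist_eq_zero' :=
  fun W _ _ _ Dt hopt _ => h W Dt hopt

/-- The v1 transcription of Thm. 1.2 implies the corrected statement.
[cite: Zhai2016, Thm. 1.2 (arXiv:1409.0231 v1 chunk p0003 L11–L18 vs v2 Thm. 1.3, TeX ll. 315–321)] -/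
theorem thm12_ordTwo_LAlg_twist_eq_one'_of_v1 (h : thm12_ordTwo_LAlg_twist_eq_one) :
    thm12_ordTwo_LAlg_twist_eq_one' :=
  fun W _ _ _ Dt hopt _ => h W Dt hopt

/-- The v1 transcription of Thm. 1.3 (no Manin / no `E[2](ℚ) ≠ 0` binder) implies the corrected statement.
[cite: Zhai2016, Thm. 1.3 (arXiv:1409.0231 v1 chunk p0003 L51–L58 vs v2 Thm. 1.5, TeX ll. 350–356)] -/
theorem thm13_ordTwo_LAlg_primeTwist_eq_zero'_of_v1 (h : thm13_ordTwo_LAlg_primeTwist_eq_zero) :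
    thm13_ordTwo_LAlg_primeTwist_eq_zero' :=
  fun W _ _ _ Dt hopt _ hΔ _ => h W Dt hopt hΔ

/-- The v1 transcription of Thm. 1.5 implies the corrected statement.
[cite: Zhai2016, Thm. 1.5 (arXiv:1409.0231 v1 chunk p0003 L105–L110 vs v2 Thm. 1.7, TeX ll. 393–399)] -/
theorem thm15_ordTwo_LAlg_primeTwist_eq_one'_of_v1 (h : thm15_ordTwo_LAlg_primeTwist_eq_one) :
    thm15_ordTwo_LAlg_primeTwist_eq_one' :=
  fun W _ _ _ Dt hopt _ hΔ _ => h W Dt hopt hΔ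

end Literature.NumberTheory.EllipticCurves.Zhai2016

end
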